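/-
Copyright (c) 2026 the pub-hodgecm-mathlib formalisation cell (harness21).  Prover seat hodgecm-mathlib-LH4-p12 (g4), Track A «(D-RAM) FOUR-FRAME», unit U2H, the census leaf
(ρ2b′-X) `stub_U2H_fixedPointCensus_typeTwo_unit0` — RHO2BX-ORDER v1 (payer LH4-p14 (g3)) organ O-Cone, the LEVEL-`b` TRANSPORT, direction «IN»: the W-part of a cone member at tube
coordinate `b` (★ T2b's binders) is a depth-refined level-`b` member of the line model.  2026-09-04.
-/
import Summits.HodgeConjecture.HodgeConjecture.Theorems.F0P3cDyRamConeLevelTransportOut   -- «OUT» twin: (K1)–(K4), (C′≤), (L←); brings ★ (C)(D1–D4), ★ (A)(B)(C′), ★ (W), ★ DEFS leaf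
import HarnessLib

/-!
# Crux `H413`, line LH4 «(D-RAM) FOUR-FRAME», leaf (ρ2b′-X) — organ O-Cone, LEVEL-`b` TRANSPORT «IN»: a `γ₂`-fixed full lattice `B ⊂ E²` with T2b's binders at tube `b ≥ 1`
# (dual generator `w₀`: (G1) `B = B^♯ ∩ {|⟨w₀,·⟩| ≤ 1}`, `B^♯ = B + 𝒪w₀`, `|⟨w₀,w₀⟩|·|ϖ|^{2b} = 1`, tube criterion `γ₂w₀ − u•w₀ ∈ B`) has `φ(B) ∈ levelSetDep(j, b; lam − jE u)`
# for THE conductor exponent `j` with `lam ∈ 𝒪_j`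

Cell `hodgecm-mathlib` (D-0151), FLOOR 0, crux H413 = `stmt-HodgeConjecture-24833`, unit U2H, leaf (ρ2b′-X) (OPEN-CONFIRMED, T18-55); RHO2BX-ORDER v1 organ **O-Cone** (LH4-p12 (g4));
statement-first HEAD `F0/P3c/LH4/LH4-p12/g4/t3/F0P3cDyRamConeLevelTransport.HEAD.v1` 141ee991 sentence (L→) (+ binders `hgen`, `hu`; REF5 R5-154 ∕ LH4-p05 (g4) «=»).  THEOREMS ONLY (no
`def`, no instance, no notation, no `sorry`); lane `--supports stmt-HodgeConjecture-24833 --as helper` (count-neutral).  WHY: see the «OUT» twin — the pair (L→)(L←) identifies the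
INDEX SET of the cone sum `Σ_{b ≥ 1} Σ_{(B,b)} #fibre(B,b)` (★ T2a∕T2b∕T2c) with `⋃_j levelSetDep(j, b; lam − jE u) ∩ {lam ∈ 𝒪_j}` of the line model, which T5a∕b∕c tabulate.
Direction here: W-side ⇒ M-side.  THE ARGUMENT (pure order arithmetic, [Jacobowitz1962, §4]): with `Λ = φ(B) = x₀𝒪_c` (★ (D1)), `D := Λ^# = Y⁻¹Λ` (★ T4c; `Y` = the dual
generator) and `m₀ := φ(w₀) = Y⁻¹x₀z₀`: (G1) both ways + (K4) give the KEY EQUIVALENCE (A) `jE(s)·m₀ ∈ Λ ⟺ |jE s| ≤ |ϖE|^{2b}`; `hgen` gives `z = jE(t)z₀ + Y·a` for every `z ∈ 𝒪_c`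
(cyclicity of `𝒪_c∕Y𝒪_c`), whence `|Y| < 1` (else `m₀ ∈ Λ`), PRIMITIVITY `Y∕ϖE ∉ 𝒪_c` (else `1, cα` are both `𝒪_E`-multiples of `z₀` mod `ϖE`, and the coordinate criterion ★
`div_mem_order_iff_coords_lt_one` makes `|1| < 1`), `|z₀| = 1`, exact depth `|Y − ρY| = |c(α − ρα)|`; then (B) `jE(s)·m₀ ∈ Λ ⟺ |jE s| ≤ |Y|²` (§1), and (A) = (B) at `s = ϖ^{2b}` and at
`jE s = YρY` pins `|Y|² = |ϖE|^{2b}`, i.e. LEVEL `b`; the depth clause `(lam − jE u)·D ⊆ Λ` is `hgen` + the tube criterion + `λ`-, `𝒪_E`-stability.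
* §1 `isOrd_fixed_div_iff` (`t∕Y ∈ 𝒪_c ⟺ |t| ≤ |Y|²` for fixed `t`, exact depth), `isOrd_mul_div_iff_of_v_eq_one` (a unit `z₀ ∈ 𝒪_cˣ` does not matter).
* §2 **(L→) `exists_mem_levelSetDep_map`**.
HONEST LABEL: count-neutral; HC_CM is proved only modulo the 7 printed citations (2 remaining named inputs: hLiu418 = `stmt-HodgeConjecture-24832`, h413 = `stmt-HodgeConjecture-24833`) until
rung 0 closes.

## References
* [Kottwitz1986BaseChangeUnits] R. E. Kottwitz, *Base change for unit elements of Hecke algebras*, Compositio Math. 60 (1986), §1 pp. 240–241.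
* [Jacobowitz1962] R. Jacobowitz, *Hermitian forms over local fields*, Amer. J. Math. 84 (1962), §4 (duals, modular components, gluing).
* [BruhatTits1972] F. Bruhat, J. Tits, *Groupes réductifs sur un corps local I*, Publ. Math. IHÉS 41 (1972), §10.
-/

set_option autoImplicit false

noncomputable section

open scoped Valued WithZero Matrix MatrixGroups
open WithZero
open scoped Classical
open Literature.NumberTheory.Automorphic Literature.NumberTheory.Automorphic.HermitianLattice Literature.NumberTheory.Automorphic.UnitaryLatticeTree
open Literature.NumberTheory.Automorphic.EllipticPlaneAsFieldLine
open Literature.NumberTheory.LocalFields.QuadraticOrder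
open Summit.HodgeConjecture.HodgeConjecture.Cruxes.H413.F0P3cDyRamToricCensusDefs
open Summit.HodgeConjecture.HodgeConjecture.Cruxes.H413.F0P3cDyRamWSideOrderCensus

namespace Summit.HodgeConjecture.HodgeConjecture.Cruxes.H413.F0P3cDyRamConeLevelTransport

variable {E M : Type*} [Field E] [Valued E ℤᵐ⁰] [Field M] [Valued M ℤᵐ⁰] {ρ Θ : M →+* M} {α : M}

/-! ## §1 Two order-arithmetic lemmas -/

/-- **`t∕Y ∈ 𝒪_c ⟺ |t| ≤ |Y|²`** for a fixed `t`, when `Y` (`|Y| ≤ 1`) has EXACT depth `|Y − ρY| = |c(α − ρα)|`. [cite: Jacobowitz1962, §4] -/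
theorem isOrd_fixed_div_iff (hvρ : ∀ x, Valued.v (ρ x) = Valued.v x) {c y t : M} (hy0 : y ≠ 0) (hy1 : Valued.v y ≤ 1)
    (hdepth : Valued.v (y - ρ y) = Valued.v (c * (α - ρ α))) (hcd : c * (α - ρ α) ≠ 0) (ht : ρ t = t) :
    IsOrd ρ α c (t / y) ↔ Valued.v t ≤ Valued.v y ^ 2 := by
  have hvy0 : Valued.v y ≠ 0 := (Valuation.ne_zero_iff _).2 hy0
  have hvypos : 0 < Valued.v y := zero_lt_iff.2 hvy0
  have hρy0 : ρ y ≠ 0 := (map_ne_zero ρ).2 hy0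
  have hvcd : 0 < Valued.v (c * (α - ρ α)) := zero_lt_iff.2 ((Valuation.ne_zero_iff _).2 hcd)
  have hrew : t / y - ρ (t / y) = t * (ρ y - y) / (y * ρ y) := by rw [map_div₀, ht, div_sub_div _ _ hy0 hρy0]; ring
  have hρclause : Valued.v (t / y - ρ (t / y)) ≤ Valued.v (c * (α - ρ α)) ↔ Valued.v t ≤ Valued.v y ^ 2 := by
    rw [hrew, map_div₀, Valuation.map_mul, Valuation.map_mul, hvρ, Valuation.map_sub_swap, hdepth, div_le_iff₀ (mul_pos hvypos hvypos),
      mul_comm (Valued.v (c * (α - ρ α))) (Valued.v y * Valued.v y), ← sq]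
    exact mul_le_mul_iff_of_pos_right hvcd
  rw [isOrd_iff, hρclause, map_div₀, div_le_one₀ hvypos]
  exact ⟨fun h => h.2, fun h => ⟨h.trans (by rw [sq]; exact mul_le_of_le_one_left' hy1), h⟩⟩

/-- A unit `z₀` of `𝒪_c` (`z₀ ∈ 𝒪_c`, `|z₀| = 1`) does not change membership: `t·z₀∕Y ∈ 𝒪_c ⟺ t∕Y ∈ 𝒪_c`. [cite: Jacobowitz1962, §4] -/
theorem isOrd_mul_div_iff_of_v_eq_one (hρρ : ∀ x, ρ (ρ x) = x) (hvρ : ∀ x, Valued.v (ρ x) = Valued.v x) {c y z₀ : M} (hy0 : y ≠ 0)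
    (hz₀ : IsOrd ρ α c z₀) (hz₀1 : Valued.v z₀ = 1) (t : M) : IsOrd ρ α c (t * z₀ / y) ↔ IsOrd ρ α c (t / y) := by
  have hz₀0 : z₀ ≠ 0 := fun h0 => by rw [h0, map_zero] at hz₀1; exact zero_ne_one hz₀1
  have hinv : IsOrd ρ α c z₀⁻¹ := inv_mem_order_of_mem_order hρρ hvρ hz₀1 hz₀
  constructor
  · intro hO
    have hm : IsOrd ρ α c (t * z₀ / y * z₀⁻¹) := mul_mem_order hvρ hO hinv
    have heq : t * z₀ / y * z₀⁻¹ = t / y := by field_simp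
    rwa [heq] at hm
  · intro hO
    have hm : IsOrd ρ α c (t / y * z₀) := mul_mem_order hvρ hO hz₀
    have heq : t / y * z₀ = t * z₀ / y := by rw [div_mul_eq_mul_div]
    rwa [heq] at hm

/-! ## §2 (L→) The W-part of a cone member at tube `b` is a depth-refined level-`b` member -/

/-- **(L→) `exists_mem_levelSetDep_map`.**  A full lattice `B = g·𝒪² ⊂ E²` with `γ₂B = B` and a dual generator `w₀` satisfying ★ T2b's binders — (G1) `w ∈ B ⟺ w ∈ B^♯ ∧ |⟨w₀,w⟩| ≤ 1`,
the generation `B^♯ = B + 𝒪·w₀`, `|⟨w₀,w₀⟩|·|ϖ|^{2b} = 1` (`b ≥ 1`) — and the tube criterion `γ₂w₀ − u•w₀ ∈ B` (`|u| ≤ 1`) has `φ(B) ∈ levelSetDep(j, b; lam − jE u)` for the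
conductor exponent `j` (`φ(B) = x₀𝒪_j`), and `lam ∈ 𝒪_j`. [cite: Jacobowitz1962, §4] [cite: Kottwitz1986BaseChangeUnits, §1 pp. 240–241] [cite: BruhatTits1972, §10] -/
theorem exists_mem_levelSetDep_map (σ : E →+* E) {ϖ : E} (hϖ0 : ϖ ≠ 0) (hϖ1 : Valued.v ϖ < 1) (H₂ : Matrix (Fin 2) (Fin 2) E) (jE : E →+* M)
    (hρρ : ∀ x, ρ (ρ x) = x) (hvρ : ∀ x, Valued.v (ρ x) = Valued.v x) (hα : ρ α ≠ α) (hα1 : Valued.v α ≤ 1)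
    (hint : ∀ z : M, Valued.v z ≤ 1 → Valued.v ((z - ρ z) / (α - ρ α)) ≤ 1)
    (hΘΘ : ∀ x, Θ (Θ x) = x) (hΘρ : ∀ x, Θ (ρ x) = ρ (Θ x)) (hvΘ : ∀ x, Valued.v (Θ x) = Valued.v x)
    (hjv : ∀ c, Valued.v (jE c) ≤ 1 ↔ Valued.v c ≤ 1) (hjfix : ∀ z, ρ z = z ↔ ∃ c, jE c = z)
    (hjpow : ∀ (t : E) (n : ℤ), Valued.v (jE t) = Valued.v (jE ϖ) ^ n ↔ Valued.v t = Valued.v ϖ ^ n)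
    (hEval : ∀ c : M, ρ c = c → c ≠ 0 → Valued.v c ≤ 1 → ∃ n : ℕ, Valued.v c = Valued.v (jE ϖ) ^ n)
    (hϖmax : ∀ t : M, ρ t = t → Valued.v t < 1 → Valued.v t ≤ Valued.v (jE ϖ))
    (φ : (Fin 2 → E) →+ M) (hφs : ∀ (c : E) (x : Fin 2 → E), φ (c • x) = jE c * φ x) (hφi : Function.Injective φ) (hφo : Function.Surjective φ)
    {γ₂ : GL (Fin 2) E} {lam h : M} (hφγ : ∀ x, φ ((γ₂ : Matrix (Fin 2) (Fin 2) E).mulVec x) = lam * φ x) (hlam : Valued.v lam = 1)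
    (hΘh : Θ h = h) (hh : h ≠ 0) (hform : ∀ x y, jE (pairing σ H₂ x y) = h * Θ (φ x) * φ y + ρ (h * Θ (φ x) * φ y))
    {u : E} (hu : Valued.v u ≤ 1) {b : ℕ} (hb : 1 ≤ b) {B : Submodule 𝒪[E] (Fin 2 → E)}
    (hBg : ∃ g : GL (Fin 2) E, B = latt (g : Matrix (Fin 2) (Fin 2) E)) (hfix : mapGL γ₂ B = B) {w₀ : Fin 2 → E}
    (hG1 : ∀ w, w ∈ B ↔ (w ∈ dualLatt σ H₂ B ∧ Valued.v (pairing σ H₂ w₀ w) ≤ 1))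
    (hgen : ∀ w ∈ dualLatt σ H₂ B, ∃ (t : E) (a : Fin 2 → E), Valued.v t ≤ 1 ∧ a ∈ B ∧ w = t • w₀ + a)
    (hw₀ : Valued.v (pairing σ H₂ w₀ w₀) * Valued.v ϖ ^ (2 * b) = 1) (hdep : (γ₂ : Matrix (Fin 2) (Fin 2) E).mulVec w₀ - u • w₀ ∈ B) :
    ∃ j : ℕ, B.toAddSubgroup.map φ ∈ levelSetDep ρ Θ α (jE ϖ) h j b (lam - jE u) ∧ IsOrd ρ α (jE ϖ ^ j) lam := by
  obtain ⟨g, rfl⟩ := hBg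
  set ϖE : M := jE ϖ with hϖE
  have hρϖ : ρ ϖE = ϖE := (hjfix ϖE).2 ⟨ϖ, rfl⟩
  have hϖE0 : ϖE ≠ 0 := (map_ne_zero jE).2 hϖ0
  have hϖE1 : Valued.v ϖE < 1 := by
    refine lt_of_le_of_ne ((hjv ϖ).2 hϖ1.le) fun hle => ?_
    have := (hjpow ϖ 0).1 (by rw [zpow_zero]; exact hle)
    rw [zpow_zero] at this
    exact hϖ1.ne this
  have hd : α - ρ α ≠ 0 := sub_ne_zero.2 (Ne.symm hα)
  -- fixed integral elements `jE s` lie in every order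
  have hjO : ∀ (c : M) (s : E), Valued.v s ≤ 1 → IsOrd ρ α c (jE s) := fun c s hs => mem_order_of_fixed c ((hjfix _).2 ⟨s, rfl⟩) ((hjv s).2 hs)
  -- (D1): `Λ = φ(B) = x₀·𝒪_{c'}`, and the conductor is a power of `ϖE`
  obtain ⟨x₀, c', hx₀, hc', hc'0, hc'1, hΛ'⟩ := exists_eq_mul_order_map_latt jE hρρ hα hα1 hint hjv hjfix φ hφs hφi g
  obtain ⟨j, hj⟩ := hEval c' hc' hc'0 hc'1
  have hc : ρ (ϖE ^ j) = ϖE ^ j := by rw [map_pow, hρϖ]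
  have hc0 : ϖE ^ j ≠ 0 := pow_ne_zero j hϖE0
  have hc1 : Valued.v (ϖE ^ j) ≤ 1 := by rw [map_pow]; exact pow_le_one₀ zero_le hϖE1.le
  have hcd : ϖE ^ j * (α - ρ α) ≠ 0 := mul_ne_zero hc0 hd
  have hcc : Valued.v c' = Valued.v (ϖE ^ j) := by rw [hj, map_pow]
  set Λ : AddSubgroup M := (latt (g : Matrix (Fin 2) (Fin 2) E)).toAddSubgroup.map φ with hΛdef
  have hΛx : ∀ x, x ∈ Λ ↔ ∃ z, IsOrd ρ α (ϖE ^ j) z ∧ x = x₀ * z := fun x =>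
    (hΛ' x).trans (exists_congr fun z => and_congr_left fun _ => isOrd_congr_of_v_eq hcc z)
  have hmemΛ : ∀ z, x₀ * z ∈ Λ ↔ IsOrd ρ α (ϖE ^ j) z := by
    intro z
    refine ⟨fun hz => ?_, fun hz => (hΛx _).2 ⟨z, hz, rfl⟩⟩
    obtain ⟨z', hz', heq⟩ := (hΛx _).1 hz
    rwa [mul_left_cancel₀ hx₀ heq]
  -- `lam ∈ 𝒪_j` from `γ₂B = B`
  have hstab : ∀ x ∈ Λ, lam * x ∈ Λ := (mapGL_eq_iff_forall_mul_mem jE hρρ hvρ hα hα1 hint hjv hjfix φ hφs hφi hφγ hlam g).1 hfix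
  have hlamO : IsOrd ρ α (ϖE ^ j) lam := (forall_mul_mem_iff_isOrd hvρ hx₀ hΛx lam).1 hstab
  -- the dual `D = Λ^#` read on `M`, and the dual generator `Y`
  have hdual : ∀ w, w ∈ dualLatt σ H₂ (latt (g : Matrix (Fin 2) (Fin 2) E)) ↔ ∀ a ∈ Λ, Valued.v (h * Θ a * φ w + ρ (h * Θ a * φ w)) ≤ 1 := by
    intro w; rw [mem_dualLatt_iff_forall_v_herm_le_one σ H₂ jE ρ Θ h hjv φ hform]
  obtain ⟨Y, hY⟩ : ∃ Y, dualGen ρ Θ α (ϖE ^ j) h x₀ = Y := ⟨_, rfl⟩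
  have hΘx₀ : Θ x₀ ≠ 0 := (map_ne_zero Θ).2 hx₀
  have hY0 : Y ≠ 0 := by rw [← hY, dualGen_def]; exact mul_ne_zero (mul_ne_zero hh (mul_ne_zero hx₀ hΘx₀)) hcd
  have hvY0 : Valued.v Y ≠ 0 := (Valuation.ne_zero_iff _).2 hY0
  have hvYpos : 0 < Valued.v Y := zero_lt_iff.2 hvY0
  have hT4 : ∀ m, (∀ a ∈ Λ, Valued.v (h * Θ a * m + ρ (h * Θ a * m)) ≤ 1) ↔ ∃ z, IsOrd ρ α (ϖE ^ j) z ∧ m = Y⁻¹ * (x₀ * z) := by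
    intro m
    have := forall_mem_herm_iff_exists hρρ hvρ hα hα1 hint hΘΘ hΘρ hvΘ hc hc0 hc1 hh hx₀ hΛx m
    rwa [hY] at this
  -- `B ⊆ B^♯`: `Y ∈ 𝒪_j`
  have hintΛ : ∀ x ∈ Λ, ∀ x' ∈ Λ, Valued.v (h * Θ x * x' + ρ (h * Θ x * x')) ≤ 1 := by
    intro x hx x' hx'
    obtain ⟨w', hw', rfl⟩ := AddSubgroup.mem_map.1 hx'
    exact (hdual w').1 ((hG1 w').1 hw').1 x hx
  have hYO : IsOrd ρ α (ϖE ^ j) Y := by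
    have := (forall_mem_forall_mem_v_herm_le_one_iff hρρ hvρ hα hα1 hint hΘΘ hΘρ hvΘ hc hc0 hc1 h hΛx).1 hintΛ
    rwa [← dualGen_def ρ Θ α (ϖE ^ j) h x₀, hY] at this
  -- `m₀ := φ w₀ ∈ D` (Θ-symmetry), so `m₀ = Y⁻¹x₀z₀`
  have hm₀D : ∀ a ∈ Λ, Valued.v (h * Θ a * φ w₀ + ρ (h * Θ a * φ w₀)) ≤ 1 := by
    intro a ha
    obtain ⟨w, hw, rfl⟩ := AddSubgroup.mem_map.1 ha
    rw [v_herm_swap hΘΘ hΘρ hvΘ hΘh, ← hform, hjv]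
    exact ((hG1 w).1 hw).2
  have hw₀D : w₀ ∈ dualLatt σ H₂ (latt (g : Matrix (Fin 2) (Fin 2) E)) := (hdual w₀).2 hm₀D
  obtain ⟨z₀, hz₀, hm₀⟩ := (hT4 (φ w₀)).1 hm₀D
  -- `hgen` on `M`: every `z ∈ 𝒪_j` is `jE t · z₀ + Y·a`
  have hcoef : ∀ z, IsOrd ρ α (ϖE ^ j) z → ∃ (t : E) (a : M), Valued.v t ≤ 1 ∧ IsOrd ρ α (ϖE ^ j) a ∧ z = jE t * z₀ + Y * a := by
    intro z hz
    obtain ⟨w, hw⟩ := hφo (Y⁻¹ * (x₀ * z))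
    obtain ⟨t, a, ht, ha, hwta⟩ := hgen w ((hdual w).2 (by rw [hw]; exact (hT4 _).2 ⟨z, hz, rfl⟩))
    have haΛ : φ a ∈ Λ := AddSubgroup.mem_map.2 ⟨a, ha, rfl⟩
    obtain ⟨za, hza, hφa⟩ := (hΛx _).1 haΛ
    refine ⟨t, za, ht, hza, ?_⟩
    have heq : Y⁻¹ * (x₀ * z) = jE t * (Y⁻¹ * (x₀ * z₀)) + x₀ * za := by rw [← hw, hwta, map_add, hφs, hm₀, hφa]
    calc z = Y * x₀⁻¹ * (Y⁻¹ * (x₀ * z)) := by field_simp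
      _ = Y * x₀⁻¹ * (jE t * (Y⁻¹ * (x₀ * z₀)) + x₀ * za) := by rw [heq]
      _ = jE t * z₀ + Y * za := by field_simp
  -- the self-pairing `|T(m₀, m₀)| = |ϖE|^{−2b}`
  have hϖEb : 0 < Valued.v ϖE ^ (2 * b) := pow_pos (zero_lt_iff.2 ((Valuation.ne_zero_iff _).2 hϖE0)) _
  have hTm₀ : Valued.v (h * Θ (φ w₀) * φ w₀ + ρ (h * Θ (φ w₀) * φ w₀)) = (Valued.v ϖE ^ (2 * b))⁻¹ := by
    have h1 : Valued.v (pairing σ H₂ w₀ w₀) = Valued.v ϖ ^ (-((2 * b : ℕ) : ℤ)) := by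
      rw [zpow_neg, zpow_natCast]; exact eq_inv_of_mul_eq_one_left hw₀
    rw [← hform, (hjpow _ _).2 h1, zpow_neg, zpow_natCast]
  -- KEY (A): `jE s · m₀ ∈ Λ ⟺ |jE s| ≤ |ϖE|^{2b}` (from (G1) both ways)
  have hkeyA : ∀ s : E, Valued.v s ≤ 1 → (jE s * φ w₀ ∈ Λ ↔ Valued.v (jE s) ≤ Valued.v ϖE ^ (2 * b)) := by
    intro s hs
    have hsw : φ (s • w₀) = jE s * φ w₀ := hφs s w₀
    have hpair : Valued.v (pairing σ H₂ w₀ (s • w₀)) ≤ 1 ↔ Valued.v (jE s) ≤ Valued.v ϖE ^ (2 * b) := by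
      rw [← hjv, hform, hsw, herm_fixed_mul_eq ((hjfix _).2 ⟨s, rfl⟩), Valuation.map_mul, hTm₀, ← div_eq_mul_inv, div_le_iff₀ hϖEb, one_mul]
    constructor
    · intro hmem
      rw [← hsw] at hmem
      obtain ⟨w', hw', hww'⟩ := AddSubgroup.mem_map.1 hmem
      have hsB : s • w₀ ∈ latt (g : Matrix (Fin 2) (Fin 2) E) := by rw [← hφi hww']; exact hw'
      exact hpair.1 ((hG1 _).1 hsB).2
    · intro hle
      have hsB : s • w₀ ∈ latt (g : Matrix (Fin 2) (Fin 2) E) :=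
        (hG1 _).2 ⟨(dualLatt σ H₂ (latt (g : Matrix (Fin 2) (Fin 2) E))).smul_mem ⟨s, hs⟩ hw₀D, hpair.2 hle⟩
      rw [← hsw]; exact AddSubgroup.mem_map.2 ⟨_, hsB, rfl⟩
  -- `|Y| < 1`: otherwise `m₀ ∈ Λ`, contradicting (A) at `s = 1`
  have hm₀Λ : φ w₀ ∉ Λ := by
    intro hmem
    have h1 := (hkeyA 1 (by rw [map_one])).1 (by rwa [map_one, one_mul])
    rw [map_one, map_one] at h1
    have hlt : Valued.v ϖE ^ (2 * b) < 1 := pow_lt_one₀ zero_le hϖE1 (by omega)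
    exact lt_irrefl _ (lt_of_le_of_lt h1 hlt)
  have hY1 : Valued.v Y < 1 := by
    refine lt_of_le_of_ne hYO.1 fun hY1 => hm₀Λ ?_
    rw [hm₀, ← mul_assoc, mul_comm Y⁻¹ x₀, mul_assoc]
    exact (hmemΛ _).2 (mul_mem_order hvρ (inv_mem_order_of_mem_order hρρ hvρ hY1 hYO) hz₀)
  -- PRIMITIVITY `Y ∕ ϖE ∉ 𝒪_j`
  obtain ⟨t₁, a₁, ht₁, ha₁, heq1⟩ := hcoef 1 (one_mem_order (ρ := ρ) (α := α) (ϖE ^ j))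
  have hprimY : ¬ IsOrd ρ α (ϖE ^ j) (Y / ϖE) := by
    intro hdiv
    obtain ⟨t₂, a₂, ht₂, ha₂, heq2⟩ := hcoef (ϖE ^ j * α) (conductor_mul_alpha_mem_order hα hα1 hint hc hc1)
    have hρ1 : ρ (jE t₂) = jE t₂ := (hjfix _).2 ⟨t₂, rfl⟩
    have hρ2 : ρ (-jE t₁) = -jE t₁ := by rw [map_neg, (hjfix (jE t₁)).2 ⟨t₁, rfl⟩]
    have hkey : jE t₂ + -jE t₁ * (ϖE ^ j * α) = Y * (jE t₂ * a₁ - jE t₁ * a₂) := by linear_combination (jE t₂) * heq1 - (jE t₁) * heq2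
    have hmem : IsOrd ρ α (ϖE ^ j) ((jE t₂ + -jE t₁ * (ϖE ^ j * α)) / ϖE) := by
      rw [hkey, mul_div_right_comm]
      exact mul_mem_order hvρ hdiv (sub_mem_order (mul_mem_order hvρ (hjO _ t₂ ht₂) ha₁) (mul_mem_order hvρ (hjO _ t₁ ht₁) ha₂))
    have hlt := (div_mem_order_iff_coords_lt_one hρρ hα hα1 hint hc hc0 hc1 hρϖ hϖE0 hϖE1 hϖmax hρ1 hρ2).1 hmem
    have hlt1 : Valued.v (jE t₁) < 1 := by rw [← Valuation.map_neg]; exact hlt.2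
    have hone : Valued.v (jE t₁ * z₀ + Y * a₁) < 1 := by
      refine Valuation.map_add_lt _ ?_ ?_
      · rw [Valuation.map_mul]; exact lt_of_le_of_lt (mul_le_of_le_one_right' hz₀.1) hlt1
      · rw [Valuation.map_mul]; exact lt_of_le_of_lt (mul_le_of_le_one_right' ha₁.1) hY1
    rw [← heq1, map_one] at hone
    exact lt_irrefl _ hone
  -- coordinates of `Y`, primitivity in coordinates, exact depth
  obtain ⟨p, q, ⟨hp, hp1⟩, ⟨hq, hq1⟩, hypq⟩ := (exists_fixed_coords_iff_mem_order hρρ hα hα1 hint hc hc0 hc1 Y).2 hYO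
  have hprim : Valued.v p = 1 ∨ Valued.v q = 1 := by
    by_contra hcon
    push Not at hcon
    apply hprimY
    have := (div_mem_order_iff_coords_lt_one hρρ hα hα1 hint hc hc0 hc1 hρϖ hϖE0 hϖE1 hϖmax hp hq).2
      ⟨lt_of_le_of_ne hp1 hcon.1, lt_of_le_of_ne hq1 hcon.2⟩
    rwa [← hypq] at this
  have hcα : Valued.v (ϖE ^ j * α) ≤ 1 := by rw [Valuation.map_mul]; exact mul_le_one' hc1 hα1
  have hqu : Valued.v q = 1 := by
    rcases hprim with hpu | hqu
    · by_contra hqu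
      have hsmall : Valued.v (q * (ϖE ^ j * α)) < 1 := by
        rw [Valuation.map_mul]
        calc Valued.v q * Valued.v (ϖE ^ j * α) ≤ Valued.v q * 1 := mul_le_mul' le_rfl hcα
          _ = Valued.v q := mul_one _
          _ < 1 := lt_of_le_of_ne hq1 hqu
      have hval : Valued.v (p + q * (ϖE ^ j * α)) = 1 := by
        rw [Valuation.map_add_of_distinct_val _ (by rw [hpu]; exact hsmall.ne'), hpu, max_eq_left hsmall.le]
      rw [← hypq] at hval
      exact absurd hval hY1.ne
    · exact hqu
  have hdepth : Valued.v (Y - ρ Y) = Valued.v (ϖE ^ j * (α - ρ α)) := by rw [hypq]; exact v_sub_map_eq_of_coord_unit hc hp hq hqu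
  -- `|z₀| = 1`
  have hz₀1 : Valued.v z₀ = 1 := by
    have hsum : Valued.v (jE t₁ * z₀ + Y * a₁) = 1 := by rw [← heq1, map_one]
    by_contra hne
    have hlt : Valued.v (jE t₁ * z₀) < 1 := by
      rw [Valuation.map_mul]
      exact lt_of_le_of_lt (mul_le_of_le_one_left' ((hjv t₁).2 ht₁)) (lt_of_le_of_ne hz₀.1 hne)
    have hlt' : Valued.v (Y * a₁) < 1 := by rw [Valuation.map_mul]; exact lt_of_le_of_lt (mul_le_of_le_one_right' ha₁.1) hY1
    exact absurd hsum (Valuation.map_add_lt _ hlt hlt').ne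
  -- KEY (B): `jE s · m₀ ∈ Λ ⟺ |jE s| ≤ |Y|²`
  have hkeyB : ∀ s : E, jE s * φ w₀ ∈ Λ ↔ Valued.v (jE s) ≤ Valued.v Y ^ 2 := by
    intro s
    have heq : jE s * φ w₀ = x₀ * (jE s * z₀ / Y) := by rw [hm₀]; field_simp
    rw [heq, hmemΛ, isOrd_mul_div_iff_of_v_eq_one hρρ hvρ hY0 hz₀ hz₀1, isOrd_fixed_div_iff hvρ hY0 hYO.1 hdepth hcd ((hjfix _).2 ⟨s, rfl⟩)]
  -- LEVEL: `|Y|² = |ϖE|^{2b}`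
  have hsq : Valued.v Y ^ 2 = Valued.v ϖE ^ (2 * b) := by
    apply le_antisymm
    · obtain ⟨s, hs⟩ := (hjfix (Y * ρ Y)).1 (by rw [map_mul ρ Y (ρ Y), hρρ, mul_comm])
      have hvs : Valued.v (jE s) = Valued.v Y ^ 2 := by rw [hs, Valuation.map_mul, hvρ, sq]
      have hs1 : Valued.v s ≤ 1 := (hjv s).1 (by rw [hvs, sq]; exact mul_le_one' hYO.1 hYO.1)
      rw [← hvs]; exact (hkeyA s hs1).1 ((hkeyB s).2 hvs.le)
    · have hs1 : Valued.v (ϖ ^ (2 * b)) ≤ 1 := by rw [map_pow]; exact pow_le_one₀ zero_le hϖ1.le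
      have hvs : Valued.v (jE (ϖ ^ (2 * b))) = Valued.v ϖE ^ (2 * b) := by rw [map_pow, Valuation.map_pow]
      rw [← hvs]; exact (hkeyB _).1 ((hkeyA _ hs1).2 hvs.le)
  have hlev : Valued.v Y = Valued.v ϖE ^ b :=
    (pow_left_inj₀ zero_le zero_le two_ne_zero).1 (by rw [hsq, ← pow_mul, mul_comm])
  -- DEPTH: `(lam − jE u)·D ⊆ Λ`
  have hfixmul : ∀ (s : E) (x : M), Valued.v s ≤ 1 → x ∈ Λ → jE s * x ∈ Λ := by
    intro s x hs hx
    obtain ⟨z, hz, rfl⟩ := (hΛx x).1 hx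
    rw [mul_left_comm]
    exact (hmemΛ _).2 (mul_mem_order hvρ (hjO _ s hs) hz)
  have hdepM : ∀ m, (∀ a ∈ Λ, Valued.v (h * Θ a * m + ρ (h * Θ a * m)) ≤ 1) → (lam - jE u) * m ∈ Λ := by
    intro m hm
    obtain ⟨w, rfl⟩ := hφo m
    obtain ⟨t, a, ht, ha, hwta⟩ := hgen w ((hdual w).2 hm)
    have h1 : (lam - jE u) * φ w₀ ∈ Λ := by
      have hφ : φ ((γ₂ : Matrix (Fin 2) (Fin 2) E).mulVec w₀ - u • w₀) = (lam - jE u) * φ w₀ := by rw [map_sub, hφγ, hφs]; ring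
      rw [← hφ]; exact AddSubgroup.mem_map.2 ⟨_, hdep, rfl⟩
    have haΛ : φ a ∈ Λ := AddSubgroup.mem_map.2 ⟨a, ha, rfl⟩
    have hsplit : (lam - jE u) * φ w = jE t * ((lam - jE u) * φ w₀) + (lam * φ a - jE u * φ a) := by rw [hwta, map_add, hφs]; ring
    rw [hsplit]
    exact Λ.add_mem (hfixmul t _ ht h1) (Λ.sub_mem (hstab _ haΛ) (hfixmul u _ hu haΛ))
  -- assemble
  refine ⟨j, (mem_levelSetDep_iff ρ Θ α ϖE h j b (lam - jE u) Λ).2 ⟨(mem_levelSet_iff ρ Θ α ϖE h j b Λ).2 ⟨x₀, hx₀, hΛx, ?_, ?_, ?_⟩, hdepM⟩, hlamO⟩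
  · rw [hY]; exact hYO
  · rw [hY]; exact hprimY
  · rw [hY]; exact hlev

end Summit.HodgeConjecture.HodgeConjecture.Cruxes.H413.F0P3cDyRamConeLevelTransport

end
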